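import Literature.AlgebraicGeometry.HodgeTheory.TopDegreeClasses
import Literature.AlgebraicGeometry.HodgeTheory.HolomorphicBundleChernCharacterTopDegree
import Literature.AlgebraicGeometry.HodgeTheory.GysinFormalismPushforward
import Literature.AlgebraicGeometry.HodgeTheory.SplittingPrincipleBettiOfFlagBundle
import HarnessLib

/-!
# A morphism of smooth projective complex varieties with injective pull-back on top-degree
# cohomology is surjective; `SplittingPrincipleBetti ↔ FlagBundleSplitting`

Family `hodge`, layer `Literature/AlgebraicGeometry/HodgeTheory`. THEOREMS ONLY (no definition, no
named fact). The converse of Voisin I Lemma 7.28 («`φ : X → Y` surjective holomorphic, `X` compact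
Kähler ⟹ `φ^* : Hᵏ(Y) → Hᵏ(X)` injective», the tree's `complexBetti_map_injective_of_surjective`) in
the top degree: for a morphism `f : Y ⟶ X` of smooth projective complex varieties, `dim X = n`, if
`f^* : H²ⁿ(X(ℂ); ℂ) → H²ⁿ(Y(ℂ); ℂ)` is injective then `f` is SURJECTIVE. Proof: the image of `f` is
closed (`f` is proper); if it missed a point it would miss a closed point, i.e. a complex point `Q`
(complex points are dense in the Jacobson scheme `X`, `ComplexPoints.exists_pt_mem`), so
`f(ℂ) : Y(ℂ) → X(ℂ)` would factor through `(X ∖ {Q})(ℂ) = X(ℂ) ∖ {Q}`; but every top-degree class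
dies on the complement of a point (`restrictCompl_pt_eq_zero`: `X(ℂ) ∖ {Q}` is a connected non-compact
`2n`-manifold, Hatcher Prop. 3.29), so `f^*` would kill `H²ⁿ(X(ℂ); ℂ) ≅ ℂ` (`n ≥ 1`; for `n = 0`,
`X(ℂ)` is a single point and `Y(ℂ) ≠ ∅`).

* `surjective_of_complexBetti_map_injective` — the statement above;
* **`flagBundleSplitting_of_splittingPrincipleBetti : SplittingPrincipleBetti → FlagBundleSplitting`**
  and `flagBundleSplitting_iff_splittingPrincipleBetti` — the tree's two named facts for Grothendieck's
  *principe de scindage* (`ChernCharacterBettiUniqueness` §1: «`f^*` injective and `f^*E` flagged»;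
  `FlagBundleSplitting`: «`f` surjective and `f^*E` flagged») are EQUIVALENT, so the consumers of
  either (LEMMA U / `IsTwistNormalised.exists_ch_ratio''`; the cycle law `chₖ(F(ℂ)) ∈ algebraicClasses`
  for every vector bundle, `Summits/…/EightfoldBlochSeedsChernCharacterOnBettiAnalytificationFlagBundle`)
  rest on one and the same debt, discharged by one level of `𝐏(ℰ)`
  (`flagBundleSplitting_of_projectiveBundleTautologicalQuotient`).

Nothing here bears on any case of the Hodge conjecture.

## References

* [VoisinHodgeI2002] C. Voisin, *Hodge Theory and Complex Algebraic Geometry I* (2002), §7.3.2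
  Lemma 7.28.
* [HatcherAT2002] A. Hatcher, *Algebraic Topology* (2002), §3.3 Prop. 3.29, Thm. 3.26.
* [Hartshorne1977] R. Hartshorne, *Algebraic Geometry* (1977), II Cor. 4.8 (e), II Ex. 3.15.
* [Fulton1998] W. Fulton, *Intersection Theory*, 2nd ed. (1998), §3.2.
-/

noncomputable section

open CategoryTheory AlgebraicGeometry Topology
open Literature.AlgebraicTopology.SingularHomology Literature.AlgebraicGeometry.Motives

namespace Literature.AlgebraicGeometry.HodgeTheory

section HodgeTheory

variable {n m : ℕ} {X Y : SchemeOver ℂ}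

/-- A connected space charted on `ℝ⁰` is a single point (chart sources are open singletons, so the
topology is discrete). [folklore] -/
private theorem subsingleton_of_chartedSpace_euclidean_fin_zero (M : Type) [TopologicalSpace M]
    [ChartedSpace (EuclideanSpace ℝ (Fin 0)) M] [ConnectedSpace M] : Subsingleton M := by
  have hopen : ∀ x : M, IsOpen ({x} : Set M) := fun x ↦ by
    have hsub : (chartAt (EuclideanSpace ℝ (Fin 0)) x).source ⊆ {x} := fun y hy ↦
      (chartAt (EuclideanSpace ℝ (Fin 0)) x).injOn hy (mem_chart_source _ x) (Subsingleton.elim _ _)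
    have heq : (chartAt (EuclideanSpace ℝ (Fin 0)) x).source = {x} :=
      Set.Subset.antisymm hsub (Set.singleton_subset_iff.2 (mem_chart_source _ x))
    exact heq ▸ (chartAt (EuclideanSpace ℝ (Fin 0)) x).open_source
  haveI : DiscreteTopology M := ⟨eq_bot_of_singletons_open hopen⟩
  exact ⟨fun x y ↦ (isPreconnected_univ (α := M)).subsingleton (Set.mem_univ x) (Set.mem_univ y)⟩

/-- **`f(ℂ)` is onto when `f^*` is injective on `H²ⁿ(X(ℂ); ℂ)`** (`f : Y ⟶ X` a morphism of smooth
projective complex varieties, `dim X = n`): otherwise `f(ℂ)` factors through `X(ℂ) ∖ {Q}` for a complex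
point `Q`, on which every top-degree class dies (`restrictCompl_pt_eq_zero`), so `f^*` kills
`H²ⁿ(X(ℂ); ℂ) ≅ ℂ`; in dimension `0`, `X(ℂ)` is a point. [cite: HatcherAT2002, §3.3 Prop. 3.29]
[cite: VoisinHodgeI2002, §7.3.2 Lemma 7.28] -/
theorem map_complexPoints_surjective_of_complexBetti_map_injective (hY : IsSmoothProjective m Y)
    (hX : IsSmoothProjective n X) (f : Y ⟶ X)
    (hf : Function.Injective (complexBetti.map f (2 * n))) :
    Function.Surjective (AlgPoints.map (L := ℂ) f) := by
  intro Q
  by_contra hQ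
  push Not at hQ
  rcases Nat.eq_zero_or_pos n with rfl | hn
  · -- `X(ℂ)` is a single point and `Y(ℂ)` is non-empty
    letI := hX.chartedSpace
    haveI := connectedSpace_complexPoints hX
    haveI : Subsingleton (ComplexPoints X) :=
      subsingleton_of_chartedSpace_euclidean_fin_zero (ComplexPoints X)
    obtain ⟨P₀⟩ := (connectedSpace_complexPoints hY).toNonempty
    exact hQ P₀ (Subsingleton.elim _ _)
  · -- `f(ℂ)` factors through the complement of `Q`, where top classes die
    have hfac : ∀ P : ComplexPoints Y, (AlgPoints.map (L := ℂ) f P).pt ∉ ({Q.pt} : Set X.left) := by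
      intro P hP
      haveI : IsProper X.hom := IsSmoothProjective.isProper_holds hX
      have h := setOf_pt_notMem_singleton_eq (X := X) Q
      have hP' : AlgPoints.map (L := ℂ) f P ∉ ({Q}ᶜ : Set (ComplexPoints X)) := by
        rw [← h]
        simpa only [Set.mem_setOf_eq, not_not] using hP
      exact hP' (hQ P)
    let g : C(ComplexPoints Y, complexPointsCompl X {Q.pt}) :=
      ⟨fun P ↦ ⟨AlgPoints.map (L := ℂ) f P, hfac P⟩,
        (AlgPoints.mapContinuous (L := ℂ) f).continuous.subtype_mk _⟩
    have hcomp : (⟨Subtype.val, continuous_subtype_val⟩ :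
        C(complexPointsCompl X {Q.pt}, ComplexPoints X)).comp g = AlgPoints.mapContinuous (L := ℂ) f :=
      rfl
    have hzero : ∀ c : complexBetti X (2 * n), complexBetti.map f (2 * n) c = 0 := by
      intro c
      change singularCohomology.map ℂ ℂ (AlgPoints.mapContinuous (L := ℂ) f) (2 * n) c = 0
      rw [← hcomp, singularCohomology.map_comp, ModuleCat.comp_apply]
      change singularCohomology.map ℂ ℂ g (2 * n) (complexBetti.restrictCompl X {Q.pt} (2 * n) c) = 0
      rw [restrictCompl_pt_eq_zero hX hn Q c, map_zero]
    -- a non-zero top class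
    have h1 := finrank_complexBetti_two_mul_eq_one hX
    obtain ⟨c, hc⟩ : ∃ c : complexBetti X (2 * n), c ≠ 0 := by
      by_contra h
      push Not at h
      haveI : Subsingleton (complexBetti X (2 * n)) := ⟨fun a b ↦ by rw [h a, h b]⟩
      rw [Module.finrank_zero_of_subsingleton] at h1
      exact zero_ne_one h1
    exact hc (hf (by rw [hzero c, map_zero]))

/-- **A morphism of smooth projective complex varieties whose pull-back is injective on top-degree
cohomology is surjective** (converse of Voisin I Lemma 7.28 in degree `2 dim X`): the image is
closed (`f` is proper) and contains every complex point
(`map_complexPoints_surjective_of_complexBetti_map_injective`), and complex points are dense in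
every non-empty locally closed subset (`ComplexPoints.exists_pt_mem`).
[cite: VoisinHodgeI2002, §7.3.2 Lemma 7.28] [cite: Hartshorne1977, II Cor. 4.8 (e)] -/
theorem surjective_of_complexBetti_map_injective (hY : IsSmoothProjective m Y)
    (hX : IsSmoothProjective n X) (f : Y ⟶ X)
    (hf : Function.Injective (complexBetti.map f (2 * n))) : Surjective f.left := by
  haveI : IsProper f.left := isProper_left_of_isSmoothProjective hY hX f
  haveI : IsProper X.hom := IsSmoothProjective.isProper_holds hX
  have hcl : IsClosed (Set.range f.left.base) := f.left.isClosedMap.isClosed_range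
  refine ⟨fun x ↦ ?_⟩
  by_contra hx
  have hne : (Set.range f.left.base)ᶜ.Nonempty := ⟨x, hx⟩
  obtain ⟨Q, hQ⟩ := ComplexPoints.exists_pt_mem (X := X) hne hcl.isOpen_compl.isLocallyClosed
  obtain ⟨P, hP⟩ := map_complexPoints_surjective_of_complexBetti_map_injective hY hX f hf Q
  exact hQ ⟨P.pt, by rw [← hP, AlgPoints.pt_map]⟩

/-- **`SplittingPrincipleBetti → FlagBundleSplitting`**: the map `f : Y ⟶ X` of
`SplittingPrincipleBetti` has `f^*` injective in every degree, in particular in degree `2 dim X`, hence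
is surjective (`surjective_of_complexBetti_map_injective`). [cite: VoisinHodgeI2002, §7.3.2 Lemma 7.28]
[cite: Fulton1998, §3.2] -/
theorem flagBundleSplitting_of_splittingPrincipleBetti (h : SplittingPrincipleBetti) :
    FlagBundleSplitting := by
  intro n X hX F hF
  obtain ⟨m, Y, f, hY, hinj, hflag⟩ := h n X hX F hF
  exact ⟨m, Y, f, hY, surjective_of_complexBetti_map_injective hY hX f (hinj (2 * n)), hflag⟩

/-- **The two named facts for the principe de scindage are equivalent**:
`FlagBundleSplitting ↔ SplittingPrincipleBetti`. [cite: Fulton1998, §3.2]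
[cite: VoisinHodgeI2002, §7.3.2 Lemma 7.28] -/
theorem flagBundleSplitting_iff_splittingPrincipleBetti :
    FlagBundleSplitting ↔ SplittingPrincipleBetti :=
  ⟨splittingPrincipleBetti_of_flagBundleSplitting, flagBundleSplitting_of_splittingPrincipleBetti⟩

end HodgeTheory

end Literature.AlgebraicGeometry.HodgeTheory

end
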